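import Literature.NumberTheory.Automorphic.SplitTorusOrderFixedSide     -- ★ Σ2-F p845928 (A-p19): `const_mem_comap_adjoin`, `isLocalRing_comap_adjoin`, `index_comap_adjoin_sq`, `relIndex_comap_norm_eq_index_units_fixedSide` (brings ★ O8a-1, ★ O3∕O4, ★ O1∕O2)
import Literature.NumberTheory.Automorphic.SplitTorusOrderUnitIndex     -- ★ O8a-5E p845818 (this seat): `relIndex_units_adjoin_range_unitsMap_eq`, `ringHom_pi_subtype_comp_eval_eq_compLeft`, `comap_compLeft_adjoin_coe_toSubring_eq`
import HarnessLib

/-!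
# The composed unit index `[C : 𝒪[γ]^×] = (q + 1)^{n−1} q^{S−(n−1)}` for the norm group `C = {c : c·σ(c) ∈ 𝒪[γ]^×}` of the monogenic order of a deep regular `γ` at an inert
# place — T3′ organ O8a-5Σ, the last line of the seam «O4 ∘ O2 ∘ O3 ∘ O1» (Neukirch, *ANT*, Ch. I §12; Rogawski (1990) §4.9 Lemma 4.9.3)

Topic `NumberTheory/Automorphic`; namespace `Literature.NumberTheory.Automorphic`.  THEOREMS ONLY (no definition, no instance, no notation, no named fact, no `sorry`).  Cell
`pub/hodgecm-mathlib` (D-0151), crux H413 = `stmt-HodgeConjecture-24833`; road «S3-tree» (LEAD F0P3a-plan (g11), architect A-p16 (g29)), brick T3′ «DEPTH-ZERO κ-TRANSFER» (holder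
F0P3b-p01 (g11), DESIGN v1 419b4e54 §1: `[C : R₀^×] = [𝒪_A^× : R₀^×] ∕ [𝒪_{A^σ}^× : R₀^{σ×}] = (q+1)² q^{S−2}` for `n = 3`; DESIGN v2 §2 (P-1): `n₂ = [C : R^×]` on the parity literal),
organ **O8a-5Σ** (F0P3-p02 (g14), TAKING 17:24:17Z).  CURRENCY = ★ Σ2-F (`SplitTorusOrderFixedSide`, A-p19 (g25)) VERBATIM: two (D0) valued fields `F` (fixed) and `E` (nodes),
`ι : F →+* E`, `ιO : 𝒪[F] →+* 𝒪[E]`, `σ : E →+* E`, the inert-place dictionary binders (all ★-dischargeable at `(F_v, E_w, toPlace v w)`); TOKENS = ★ O8a-1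
(`SplitTorusOrderSelfDualTorsor`, F0P3b-p01): `R^× := (Algebra.adjoin 𝒪[E] {γ}).toSubmonoid.units ≤ (Fin n → E)ˣ`, `N := id * Units.map (σ componentwise)`, `C := R^×.comap N`.
HONEST LABEL: HC_CM is proved only modulo the printed citations (2 remaining named inputs hLiu418 24832, h413 24833) until rung 0 closes; this file composes five ★ organs
and asserts nothing printed.

THE MATHEMATICS.  With `G := (𝒪_E^×)ⁿ` (the image of `(Fin n → 𝒪[E])ˣ` in `(Fin n → E)ˣ`): `R^× ≤ C` (the order is σ-stable) and `C ≤ G` (if `c·σ(c)` is a unit of the integral order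
then `v(c_i)·v(σ c_i) = 1`, and `σ` preserves `𝒪_E`, so `v(c_i) = 1`); hence `[C : R^×]·[G : C] = [G : R^×]`.  Now `[G : R^×] = (q_E − 1)^{n−1} q_E^{S−(n−1)}` is ★ O8a-5E (O1 ∘ O2
read in `(Fⁿ)ˣ`), and `[G : C] = [(𝒪_F^×)ⁿ : (R^σ)^×]` is ★ Σ2-F (d) (norm onto at an inert place, ★ O4 (a)), which ★ O2 evaluates to `(q_F − 1)^{n−1} q_F^{S−(n−1)}` once `R^σ`
contains the constants (★ Σ2-F (a)), is local (★ Σ2-F (b)) and has index `q_F^S` (★ Σ2-F (c) `[𝒪_Fⁿ : R^σ]² = [𝒪_Eⁿ : R]` with ★ O1 `[𝒪_Eⁿ : R] = q_E^S`, `q_E = q_F²`).  Cancelling,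
**`[C : R^×] = (q_F + 1)^{n−1} q_F^{S−(n−1)}`** (`n = 3`: `(q+1)² q^{S−2}`, the regular-unipotent stratum count `n₂` of DESIGN v1 §1, 10∕10 against cert §10).

* `units_adjoin_le_comap_norm` (`R^× ≤ C`), `apply_mem_integer_of_mem_adjoin`, `comap_norm_units_adjoin_le_range_unitsMap` (`C ≤ G`), **`relIndex_units_adjoin_comap_norm_eq`** (O8a-5Σ).

## References
* [Neukirch1999] J. Neukirch, *Algebraic Number Theory*, Grundlehren 322 (1999): Ch. I §12 (orders, conductor, the unit index in the class number formula of an order).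
* [SerreLocalFields1979] J.-P. Serre, *Local Fields*, GTM 67 (1979): Ch. II §2 (valuations and automorphisms), Ch. III §6 (orders `A[x]`), Ch. V §2 (norms of units, unramified case).
* [Rogawski1990] J. D. Rogawski, *Automorphic Representations of Unitary Groups in Three Variables* (1990): §4.9 Lemma 4.9.3 p. 56 (where the count is consumed).
-/

set_option autoImplicit false

noncomputable section

open scoped ValuativeRel
open Finset ValuativeRel

namespace Literature.NumberTheory.Automorphic

variable {F E : Type*} [Field F] [ValuativeRel F] [Field E] [ValuativeRel E] {n : ℕ}
  (ι : F →+* E) (ιO : 𝒪[F] →+* 𝒪[E]) (σ : E →+* E)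

/-- `R^× ≤ C`: a unit of the σ-stable order `𝒪[γ]` has its norm `u·σ(u)` in `R^×` (O8a-1's `C := R^×.comap N`). [cite: Neukirch1999, Ch. I §12] -/
theorem units_adjoin_le_comap_norm (γ : Fin n → E)
    (hσγ : ∀ x ∈ Algebra.adjoin 𝒪[E] ({γ} : Set (Fin n → E)), (fun i => σ (x i)) ∈ Algebra.adjoin 𝒪[E] ({γ} : Set (Fin n → E))) :
    (Algebra.adjoin 𝒪[E] ({γ} : Set (Fin n → E))).toSubmonoid.units ≤
      ((Algebra.adjoin 𝒪[E] ({γ} : Set (Fin n → E))).toSubmonoid.units).comap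
        (MonoidHom.id (Fin n → E)ˣ * (Units.map (RingHom.pi fun i : Fin n => σ.comp (Pi.evalRingHom (fun _ : Fin n => E) i)).toMonoidHom)) := by
  intro u hu
  rw [Subgroup.mem_comap, MonoidHom.mul_apply, MonoidHom.id_apply]
  refine Subgroup.mul_mem _ hu ?_
  rw [Submonoid.mem_units_iff] at hu ⊢
  rw [← map_inv]
  exact ⟨hσγ _ hu.1, hσγ _ hu.2⟩

/-- Elements of `Algebra.adjoin 𝒪 {γ}` with integral nodes `γ_i ∈ 𝒪` have integral coordinates. [cite: SerreLocalFields1979, Ch. III §6] -/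
theorem apply_mem_integer_of_mem_adjoin {γ : Fin n → E} (hγ : ∀ i, γ i ∈ 𝒪[E]) {x : Fin n → E}
    (hx : x ∈ Algebra.adjoin 𝒪[E] ({γ} : Set (Fin n → E))) (i : Fin n) : x i ∈ 𝒪[E] := by
  induction hx using Algebra.adjoin_induction generalizing i with
  | mem y hy => rw [Set.mem_singleton_iff] at hy; subst hy; exact hγ i
  | algebraMap r => exact r.2
  | add y z _ _ hy hz => exact Subring.add_mem _ (hy i) (hz i)
  | mul y z _ _ hy hz => exact Subring.mul_mem _ (hy i) (hz i)

/-- **`C ≤ (𝒪^×)ⁿ`**: if `c ∈ (Fⁿ)ˣ` has `c·σ(c) ∈ 𝒪[γ]^×` (integral nodes) and `σ` is an involution preserving `𝒪`, then every coordinate of `c` has valuation `1`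
(`v(c_i)·v(σc_i) = 1` and `v(x) ≤ 1 ↔ v(σx) ≤ 1`), so `c` is the image of a unit of `𝒪ⁿ`. [cite: SerreLocalFields1979, Ch. II §2] -/
theorem comap_norm_units_adjoin_le_range_unitsMap (hσσ : ∀ a, σ (σ a) = a) (hσO : ∀ a : 𝒪[E], σ a ∈ 𝒪[E]) {γ : Fin n → E}
    (hγ : ∀ i, γ i ∈ 𝒪[E]) :
    ((Algebra.adjoin 𝒪[E] ({γ} : Set (Fin n → E))).toSubmonoid.units).comap
        (MonoidHom.id (Fin n → E)ˣ * (Units.map (RingHom.pi fun i : Fin n => σ.comp (Pi.evalRingHom (fun _ : Fin n => E) i)).toMonoidHom)) ≤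
      (Units.map (RingHom.pi fun i : Fin n => (𝒪[E]).subtype.comp (Pi.evalRingHom (fun _ : Fin n => 𝒪[E]) i)).toMonoidHom).range := by
  intro c hc
  rw [Subgroup.mem_comap, Submonoid.mem_units_iff] at hc
  set w : (Fin n → E)ˣ :=
    (MonoidHom.id (Fin n → E)ˣ * (Units.map (RingHom.pi fun i : Fin n => σ.comp (Pi.evalRingHom (fun _ : Fin n => E) i)).toMonoidHom)) c with hw
  have hwi : ∀ i, (w : Fin n → E) i = (c : Fin n → E) i * σ ((c : Fin n → E) i) := fun i => norm_units_apply σ c i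
  have hw1 : ∀ i, (w : Fin n → E) i ∈ 𝒪[E] := apply_mem_integer_of_mem_adjoin hγ hc.1
  have hw2 : ∀ i, ((w⁻¹ : (Fin n → E)ˣ) : Fin n → E) i ∈ 𝒪[E] := apply_mem_integer_of_mem_adjoin hγ hc.2
  -- `σ` preserves `𝒪` in both directions
  have hσmem : ∀ x : E, x ∈ 𝒪[E] ↔ σ x ∈ 𝒪[E] :=
    fun x => ⟨fun hx => hσO ⟨x, hx⟩, fun hx => by simpa [hσσ] using hσO ⟨σ x, hx⟩⟩
  -- every coordinate of `c` has valuation `1`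
  have hval : ∀ i, valuation E ((c : Fin n → E) i) = 1 := by
    intro i
    set a : E := (c : Fin n → E) i with ha
    have hinv : ((w⁻¹ : (Fin n → E)ˣ) : Fin n → E) i * (a * σ a) = 1 := by
      have := congrFun w.inv_mul i
      rwa [Pi.mul_apply, hwi i, Pi.one_apply] at this
    have hne : a * σ a ≠ 0 := fun h0 => by rw [h0, mul_zero] at hinv; exact zero_ne_one hinv
    have ha0 : a ≠ 0 := fun h0 => hne (by rw [h0, zero_mul])
    have hσa0 : σ a ≠ 0 := fun h0 => hne (by rw [h0, mul_zero])
    have hprod1 : valuation E (a * σ a) ≤ 1 := (Valuation.mem_integer_iff _ _).1 (hwi i ▸ hw1 i)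
    have hprod2 : 1 ≤ valuation E (a * σ a) := by
      have h2 := (Valuation.mem_integer_iff _ _).1 (hw2 i)
      have heq : ((w⁻¹ : (Fin n → E)ˣ) : Fin n → E) i = (a * σ a)⁻¹ := eq_inv_of_mul_eq_one_left hinv
      rw [heq, map_inv₀] at h2
      exact (inv_le_one₀ ((Valuation.pos_iff _).2 hne)).1 h2
    have hprod : valuation E a * valuation E (σ a) = 1 := by rw [← map_mul]; exact le_antisymm hprod1 hprod2
    rcases le_or_gt (valuation E a) 1 with hle | hlt
    · -- `a ∈ 𝒪` ⇒ `σ a ∈ 𝒪` ⇒ `v(σ a) ≤ 1` ⇒ `v a ≥ 1`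
      have hσle : valuation E (σ a) ≤ 1 := (Valuation.mem_integer_iff _ _).1 ((hσmem a).1 ((Valuation.mem_integer_iff _ _).2 hle))
      refine le_antisymm hle ?_
      calc (1 : ValueGroupWithZero E) = valuation E a * valuation E (σ a) := hprod.symm
        _ ≤ valuation E a * 1 := by gcongr
        _ = valuation E a := mul_one _
    · -- `a⁻¹ ∈ 𝒪` ⇒ `σ a⁻¹ ∈ 𝒪` ⇒ `v(σ a) ≥ 1` ⇒ `v(a σ a) > 1`, absurd
      exfalso
      have hainv : a⁻¹ ∈ 𝒪[E] := by
        rw [Valuation.mem_integer_iff, map_inv₀]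
        exact (inv_le_one₀ ((Valuation.pos_iff _).2 ha0)).2 hlt.le
      have hσinv : valuation E (σ a)⁻¹ ≤ 1 := by
        have := (Valuation.mem_integer_iff _ _).1 ((hσmem _).1 hainv)
        rwa [map_inv₀ σ] at this
      have hσge : 1 ≤ valuation E (σ a) := by
        rw [map_inv₀] at hσinv
        exact (inv_le_one₀ ((Valuation.pos_iff _).2 hσa0)).1 hσinv
      have : (1 : ValueGroupWithZero E) < valuation E a * valuation E (σ a) :=
        calc (1 : ValueGroupWithZero E) = 1 * 1 := (mul_one 1).symm
          _ ≤ 1 * valuation E (σ a) := by gcongr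
          _ < valuation E a * valuation E (σ a) := mul_lt_mul_of_pos_right hlt (lt_of_lt_of_le zero_lt_one hσge)
      exact this.ne' hprod
  -- hence `c` and `c⁻¹` have integral coordinates: `c` is the image of a unit of `𝒪ⁿ`
  have hc1 : ∀ i, (c : Fin n → E) i ∈ 𝒪[E] := fun i => (Valuation.mem_integer_iff _ _).2 (hval i).le
  have hcinv : ∀ i, ((c⁻¹ : (Fin n → E)ˣ) : Fin n → E) i = ((c : Fin n → E) i)⁻¹ := by
    intro i
    have := congrFun c.inv_mul i
    rw [Pi.mul_apply, Pi.one_apply] at this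
    exact eq_inv_of_mul_eq_one_left this
  have hc2 : ∀ i, ((c⁻¹ : (Fin n → E)ˣ) : Fin n → E) i ∈ 𝒪[E] := fun i => by
    rw [hcinv i, Valuation.mem_integer_iff, map_inv₀, hval i, inv_one]
  refine ⟨⟨fun i => ⟨(c : Fin n → E) i, hc1 i⟩, fun i => ⟨((c⁻¹ : (Fin n → E)ˣ) : Fin n → E) i, hc2 i⟩, ?_, ?_⟩, Units.ext (funext fun i => rfl)⟩
  · funext i; apply Subtype.ext
    have := congrFun c.mul_inv i
    simpa using this
  · funext i; apply Subtype.ext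
    have := congrFun c.inv_mul i
    simpa using this

/-- **O8a-5Σ — THE COMPOSED INDEX `[C : R^×] = (q + 1)^{n−1} q^{S−(n−1)}`** (DESIGN v1 §1 ∕ v2 §2 (P-1): the seam «O4 (c) ∘ O2 ∘ O3 ∘ O1» CLOSED BY NAME; O8d-1's `hK₂` value
up to the parity sign).  Currency = ★ Σ2-F's two valued fields `F ⊂ E` (`ι`, `ιO`, involution `σ`, inert dictionary binders `hιO hιinj hfixO hσι hσσ hσO hmove hιm`, `2 ∈ 𝒪_E^×`,
skew unit `δ`), `#𝓀_E = (#𝓀_F)²`, deep regular nodes `γ : Fin n → 𝒪[E]` (`v(γ_j − γ_i) = v(ϖ_E)^{N i j}`, `N i j ≥ 1`), `𝒪[γ]` σ-stable; tokens `R^× := (adjoin 𝒪[E] {↑γ}).toSubmonoid.units`,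
`C := R^×.comap (id * Units.map (σ componentwise))` = ★ O8a-1 VERBATIM.  PROOF: `R^× ≤ C ≤ G := (𝒪_Eˣ)ⁿ`, so `[C : R^×]·[G : C] = [G : R^×]` (Mathlib `Subgroup.relIndex_mul_relIndex`);
`[G : R^×] = (q²−1)^{n−1}(q²)^{S−(n−1)}` (★ O8a-5E `relIndex_units_adjoin_range_unitsMap_eq`); `[G : C] = [(𝒪_Fˣ)ⁿ : RF^×]` (★ Σ2-F (d)) `= (q−1)^{n−1} q^{S−(n−1)}` (★ O2
`index_range_units_map_eq_of_index_eq_pow` at `RF`, with ★ Σ2-F (a)(b) and `[𝒪_Fⁿ : RF] = q^S` from ★ Σ2-F (c) + ★ O1 `index_adjoin_singleton_eq_pow_sum`); cancel.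
[cite: Neukirch1999, Ch. I §12] [cite: Rogawski1990, §4.9 Lemma 4.9.3 p. 56] -/
theorem relIndex_units_adjoin_comap_norm_eq [UniformSpace E] [IsUniformAddGroup E] [IsNonarchimedeanLocalField E]
    [IsDiscreteValuationRing 𝒪[E]] [Finite 𝓀[E]] [IsDiscreteValuationRing 𝒪[F]] [Finite 𝓀[F]]
    (hιO : ∀ x : 𝒪[F], ((ιO x : 𝒪[E]) : E) = ι x) (hιinj : Function.Injective ιO)
    (hfixO : ∀ y : 𝒪[E], σ y = y → ∃ x, ιO x = y) (hσι : ∀ x : F, σ (ι x) = ι x)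
    (hσσ : ∀ a, σ (σ a) = a) (hσO : ∀ a : 𝒪[E], σ a ∈ 𝒪[E]) (hmove : ∃ a : 𝒪[E], IsUnit ((⟨σ a, hσO a⟩ : 𝒪[E]) - a))
    (hιm : ∀ x : 𝒪[F], ιO x ∈ IsLocalRing.maximalIdeal 𝒪[E] → x ∈ IsLocalRing.maximalIdeal 𝒪[F])
    (h2 : IsUnit (2 : 𝒪[E])) (δ : 𝒪[E]) (hδ : IsUnit δ) (hσδ : σ (δ : E) = -(δ : E))
    (hq : Nat.card 𝓀[E] = Nat.card 𝓀[F] ^ 2) {ϖE : E} (hϖE : IsUniformizingElement ϖE)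
    (hn : 0 < n) (γ : Fin n → 𝒪[E]) (N : Fin n → Fin n → ℕ) (hNpos : ∀ i j : Fin n, i < j → 0 < N i j)
    (hN : ∀ i j : Fin n, i < j → valuation E (((γ j : E) - γ i)) = valuation E ϖE ^ N i j)
    (hσγ : ∀ x ∈ Algebra.adjoin 𝒪[E] ({fun i => (γ i : E)} : Set (Fin n → E)),
      (fun i => σ (x i)) ∈ Algebra.adjoin 𝒪[E] ({fun i => (γ i : E)} : Set (Fin n → E))) :
    ((Algebra.adjoin 𝒪[E] ({fun i => (γ i : E)} : Set (Fin n → E))).toSubmonoid.units).relIndex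
        (((Algebra.adjoin 𝒪[E] ({fun i => (γ i : E)} : Set (Fin n → E))).toSubmonoid.units).comap
          (MonoidHom.id (Fin n → E)ˣ * (Units.map (RingHom.pi fun i : Fin n => σ.comp (Pi.evalRingHom (fun _ : Fin n => E) i)).toMonoidHom))) =
      (Nat.card 𝓀[F] + 1) ^ (n - 1) * Nat.card 𝓀[F] ^ ((∑ i : Fin n, ∑ j ∈ Ioi i, N i j) - (n - 1)) := by
  classical
  set γE : Fin n → E := fun i => (γ i : E) with hγE
  have hγEO : ∀ i, γE i ∈ 𝒪[E] := fun i => (γ i).2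
  set A : Subalgebra 𝒪[E] (Fin n → E) := Algebra.adjoin 𝒪[E] ({γE} : Set (Fin n → E)) with hA
  set Ru : Subgroup (Fin n → E)ˣ := A.toSubmonoid.units with hRu
  set Nh : (Fin n → E)ˣ →* (Fin n → E)ˣ :=
    MonoidHom.id (Fin n → E)ˣ * (Units.map (RingHom.pi fun i : Fin n => σ.comp (Pi.evalRingHom (fun _ : Fin n => E) i)).toMonoidHom) with hNh
  set C : Subgroup (Fin n → E)ˣ := Ru.comap Nh with hC
  set coen : (Fin n → 𝒪[E]) →+* (Fin n → E) := RingHom.pi fun i : Fin n => (𝒪[E]).subtype.comp (Pi.evalRingHom (fun _ : Fin n => 𝒪[E]) i) with hcoen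
  set G : Subgroup (Fin n → E)ˣ := (Units.map coen.toMonoidHom).range with hG
  set ιOn : (Fin n → 𝒪[F]) →+* (Fin n → E) := RingHom.pi fun i : Fin n => ((𝒪[E]).subtype.comp ιO).comp (Pi.evalRingHom (fun _ : Fin n => 𝒪[F]) i) with hιOn
  set RF : Subring (Fin n → 𝒪[F]) := A.toSubring.comap ιOn with hRF
  set S : ℕ := ∑ i : Fin n, ∑ j ∈ Ioi i, N i j with hSdef
  -- the two inclusions `Ru ≤ C ≤ G`
  have hRuC : Ru ≤ C := units_adjoin_le_comap_norm σ γE hσγ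
  have hCG : C ≤ G := comap_norm_units_adjoin_le_range_unitsMap σ hσσ hσO hγEO
  -- `[G : Ru]` — ★ O8a-5E
  have hcoen' : coen.toMonoidHom = (((𝒪[E]).subtype.compLeft (Fin n)) : (Fin n → 𝒪[E]) →* (Fin n → E)) := by
    rw [hcoen, ringHom_pi_subtype_comp_eval_eq_compLeft, RingHom.toMonoidHom_eq_coe]
  have hGRu : Ru.relIndex G = (Nat.card 𝓀[E] - 1) ^ (n - 1) * Nat.card 𝓀[E] ^ (S - (n - 1)) := by
    rw [hG, hcoen']
    exact relIndex_units_adjoin_range_unitsMap_eq hϖE hn γ N hNpos hN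
  -- `[G : C] = [(𝒪_Fˣ)ⁿ : RF^×]` — ★ Σ2-F (d)
  have hGC : C.relIndex G = (Units.map RF.subtype.toMonoidHom).range.index :=
    relIndex_comap_norm_eq_index_units_fixedSide ι ιO σ hιO hιinj hfixO hσι hσσ hσO hmove γE
  -- ★ O2 at `RF`: constants (Σ2-F (a)), locality (Σ2-F (b)), index `q^S` (Σ2-F (c) + O1)
  have hconst : ∀ a : 𝒪[F], (fun _ : Fin n => a) ∈ RF := fun a => const_mem_comap_adjoin ιO γE a
  have hγc : ∀ i j : Fin n, (⟨γE i, hγEO i⟩ : 𝒪[E]) - ⟨γE j, hγEO j⟩ ∈ IsLocalRing.maximalIdeal 𝒪[E] := by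
    intro i j
    have hi : (⟨γE i, hγEO i⟩ : 𝒪[E]) = γ i := Subtype.ext rfl
    have hj : (⟨γE j, hγEO j⟩ : 𝒪[E]) = γ j := Subtype.ext rfl
    rw [hi, hj]
    rcases lt_trichotomy i j with h | rfl | h
    · have := mem_maximalIdeal_of_valuation_eq_pow hϖE (hNpos i j h) (x := γ j - γ i) (by push_cast; exact hN i j h)
      rw [← neg_sub]; exact (Ideal.neg_mem_iff _).2 this
    · simp
    · exact mem_maximalIdeal_of_valuation_eq_pow hϖE (hNpos j i h) (x := γ i - γ j) (by push_cast; exact hN j i h)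
  haveI : IsLocalRing RF := isLocalRing_comap_adjoin ιO hn hιm γE hγEO hγc
  have hRE : (A.toSubring.comap coen).toAddSubgroup.index = Nat.card 𝓀[E] ^ S := by
    rw [hcoen, ringHom_pi_subtype_comp_eval_eq_compLeft, hA, hγE, comap_compLeft_adjoin_coe_toSubring_eq γ]
    exact index_adjoin_singleton_eq_pow_sum hϖE γ N hN
  have hsq := index_comap_adjoin_sq ι ιO σ hιO hfixO hσι hσσ (fun a ha => hσO ⟨a, ha⟩) h2 δ hδ hσδ γE hσγ
  have hS : RF.toAddSubgroup.index = Nat.card 𝓀[F] ^ S := by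
    rw [hRE, hq, ← pow_mul, mul_comm, pow_mul] at hsq
    exact Nat.pow_left_injective two_ne_zero hsq
  have hO2 := (index_range_units_map_eq_of_index_eq_pow RF hconst hS).2
  -- assemble: `[C : Ru]·[G : C] = [G : Ru]`
  have hmul := Subgroup.relIndex_mul_relIndex Ru C G hRuC hCG
  rw [hGC, hGRu, RingHom.toMonoidHom_eq_coe, hO2, hq] at hmul
  -- arithmetic with `q = p + 1`
  have hq1 : 1 < Nat.card 𝓀[F] := Finite.one_lt_card
  obtain ⟨p, hp⟩ : ∃ p, Nat.card 𝓀[F] = p + 1 := ⟨Nat.card 𝓀[F] - 1, by omega⟩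
  rw [hp] at hmul ⊢
  set X := Ru.relIndex C
  set a := n - 1
  set T := S - (n - 1)
  have hsub1 : p + 1 - 1 = p := Nat.add_sub_cancel p 1
  have hsub2 : (p + 1) ^ 2 - 1 = p * (p + 2) := by
    have : (p + 1) ^ 2 = p * (p + 2) + 1 := by ring
    rw [this, Nat.add_sub_cancel]
  rw [hsub1] at hmul
  rw [hsub2, mul_pow, ← pow_mul, two_mul, pow_add] at hmul
  have key : X * (p ^ a * (p + 1) ^ T) = ((p + 1 + 1) ^ a * (p + 1) ^ T) * (p ^ a * (p + 1) ^ T) := by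
    rw [hmul]; ring
  exact Nat.eq_of_mul_eq_mul_right (Nat.mul_pos (pow_pos (by omega) _) (pow_pos (by omega) _)) key

end Literature.NumberTheory.Automorphic

end
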